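import Mathlib
import Literature.Analysis.FluidPDE.Tao2016AveragedNS.ShiftSetCascadeFlows
import Summits.NavierStokesRegularity.NavierStokesRegularity.Theorems.TaoLadderRungTwoFlatMirrorTableDefs
import Summits.NavierStokesRegularity.NavierStokesRegularity.Theorems.TaoLadderRungTwoFlatFlowSymmetriesOn
import Summits.NavierStokesRegularity.NavierStokesRegularity.Theorems.TaoLadderRungTwoFlatPulseDefs
import Summits.NavierStokesRegularity.NavierStokesRegularity.Theorems.TaoLadderRungTwoFlatPulseSymmetry
import HarnessLib

/-!
# The λ₀ = 1 layer of K_A♭, typed (continued): datum solutions and CAPTURE by a pulse (S3), over tree decls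
  (route-posited objects for item stmt-NavierStokesRegularity-22987 `FlatGapCertificatesV2`, crux K_A♭ of route
  TaoLadderRungTwoFlat; cell harvest/h2-tao-ladder, p1 g19 — tree form of theory-1 g34's (S3) `DatumCaptured`
  (cell file Sketch46.lean), generalised to an arbitrary one-shell datum `X₀ : Fin 2 → ℝ`)

Why a general datum: with the anchor `e_{n₀} = |X₀ i₀|` of the certificate format, the BARE carrier datum
`(1, 0)` admits no per-hop certificate at small `ε₀` (its pulse carries the carrier peak `0.851 < 1`, cell screen
P-p1g19-T1 (p5)); the charged datum `x0E3 = (1, 2)` does (peaks `≥ 1.8896`). So the λ₀ = 1 capture statement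
that the transfer consumes must allow the datum the certificate actually uses.

* `IsDatumSol ε X₀ X` — exact global solution of the homogeneous mirror lattice from the one-shell datum `X₀` at
  shell `0`, bounded on every compact time interval (the uniqueness class);
* `CapturedBy ε Φ X₀` — (S3): along EVERY datum solution, at some strictly increasing checkpoint times `s N`
  (one per shell) the state seen in every finite window co-moving with the front converges to SOME member
  `κ·Φ(κ·)` (`κ > 0`) of the pulse's scale family, read at phase `0`;
* `capturedBy_scale` — capture is a property of the scale family (invariant under `Φ ↦ κ'Φ(κ'·)`).

The planner's bundle (LADDER §46.13): `∃ τ Φ, IsPulse ε τ Φ ∧ IsRSymmetricTraj Φ ∧ (vacuum at −∞) ∧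
LinearisedHopContraction ε τ Φ ∧ CapturedBy ε Φ X₀`.

HONEST FRAMING: DEFINITIONS (predicates; nothing asserted about `mirrorTable ½ ½`) and one elementary lemma
about a MODEL lattice; nothing certified; nothing about the Navier–Stokes equations.
-/

noncomputable section

-- the sub-problem namespace repeats the summit name by design (D-0017)
set_option linter.dupNamespace false

namespace Summit.NavierStokesRegularity.NavierStokesRegularity.Theorems

open Set Filter Literature.Analysis.FluidPDE Literature.Analysis.FluidPDE.TaoCascade
open scoped Topology

namespace MirrorPulse

/-- A DATUM SOLUTION: an exact global solution of the homogeneous mirror lattice `T♭(ε)` with the one-shell datum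
`X₀` at shell `0` at time `0`, bounded on every compact time interval.
[cite: Tao2016AveragedNS, §4 (4.7)–(4.8); route TaoLadderRungTwoFlat, posited object] -/
def IsDatumSol (ε : ℝ) (X₀ : Fin 2 → ℝ) (X : Fin 2 → ℤ → ℝ → ℝ) : Prop :=
  IsGlobalSol ε X ∧ (∀ (i : Fin 2) (n : ℤ), X i n 0 = if n = 0 then X₀ i else 0) ∧
    ∀ T : ℝ, ∃ M : ℝ, ∀ (i : Fin 2) (n : ℤ), ∀ t ∈ Icc (-T) T, |X i n t| ≤ M

/-- **(S3) CAPTURE BY THE PULSE `Φ`**: along every datum solution from `X₀`, at strictly increasing checkpoint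
times `s N` the window state co-moving with the front, `k ↦ X_{i,N+k}(s_N)`, converges on every finite window
`|k| ≤ K` to the phase-`0` state of SOME member `κΦ(κ·)`, `κ > 0`, of the pulse's scale family. A predicate on
`(ε, Φ, X₀)`; nothing asserted. [cite: Tao2016AveragedNS, §6.2 Prop. 6.3 (checkpoint description, statement shape); route TaoLadderRungTwoFlat, posited object, λ₀ = 1 layer (S3)] -/
def CapturedBy (ε : ℝ) (Φ : Fin 2 → ℤ → ℝ → ℝ) (X₀ : Fin 2 → ℝ) : Prop :=
  ∀ X : Fin 2 → ℤ → ℝ → ℝ, IsDatumSol ε X₀ X →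
    ∃ (κ : ℝ) (s : ℕ → ℝ), 0 < κ ∧ StrictMono s ∧
      ∀ (K : ℕ) (δ : ℝ), 0 < δ → ∃ N₀ : ℕ, ∀ N : ℕ, N₀ ≤ N →
        ∀ (i : Fin 2) (k : ℤ), |k| ≤ K → |X i (N + k) (s N) - κ * Φ i k 0| ≤ δ

/-- Capture is a property of the pulse's SCALE FAMILY: captured by `Φ` iff captured by `κ'Φ(κ'·)` (`κ' > 0`).
[cite: Tao2016AveragedNS, §6.2 (statement shape); route TaoLadderRungTwoFlat, λ₀ = 1 layer (S3)] -/
theorem capturedBy_scale {ε : ℝ} {Φ : Fin 2 → ℤ → ℝ → ℝ} {X₀ : Fin 2 → ℝ} (h : CapturedBy ε Φ X₀) {κ' : ℝ}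
    (hκ' : 0 < κ') : CapturedBy ε (FlowSymmetry.scaleFam κ' Φ) X₀ := by
  intro X hX
  obtain ⟨κ, s, hκ, hs, hcap⟩ := h X hX
  refine ⟨κ / κ', s, div_pos hκ hκ', hs, fun K δ hδ => ?_⟩
  obtain ⟨N₀, hN₀⟩ := hcap K δ hδ
  refine ⟨N₀, fun N hN i k hk => ?_⟩
  have := hN₀ N hN i k hk
  have e : κ / κ' * FlowSymmetry.scaleFam κ' Φ i k 0 = κ * Φ i k 0 := by
    simp only [FlowSymmetry.scaleFam, mul_zero]
    field_simp
  rwa [e]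

/-- The λ₀ = 1 BUNDLE the planner's split consumes («MirrorSolitaryWave» at the charged datum `X₀`): a pulse that
is `R`-symmetric and incoming from vacuum, with the linearised hop contraction, capturing the datum. A predicate;
nothing asserted. [cite: Tao2016AveragedNS, §6.3–6.4 (statement shape); route TaoLadderRungTwoFlat, λ₀ = 1 layer] -/
def MirrorWaveAt (ε : ℝ) (X₀ : Fin 2 → ℝ) : Prop :=
  ∃ (τ : ℝ) (Φ : Fin 2 → ℤ → ℝ → ℝ), IsPulse ε τ Φ ∧ IsRSymmetricTraj Φ ∧
    (∀ (i : Fin 2) (n : ℤ), Tendsto (Φ i n) atBot (𝓝 0)) ∧ LinearisedHopContraction ε τ Φ ∧ CapturedBy ε Φ X₀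

/-- The bundle's pulse is residue-free (vacuum as `t → +∞` at every site), by `R`-symmetry.
[cite: Tao2016AveragedNS, §4 (4.1); route TaoLadderRungTwoFlat, λ₀ = 1 layer] -/
theorem MirrorWaveAt.residueFree {ε : ℝ} {X₀ : Fin 2 → ℝ} (h : MirrorWaveAt ε X₀) :
    ∃ (τ : ℝ) (Φ : Fin 2 → ℤ → ℝ → ℝ), IsPulse ε τ Φ ∧ CapturedBy ε Φ X₀ ∧
      ∀ (i : Fin 2) (n : ℤ), Tendsto (Φ i n) atTop (𝓝 0) := by
  obtain ⟨τ, Φ, hP, hR, hpast, -, hcap⟩ := h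
  exact ⟨τ, Φ, hP, hcap, fun i n => tendsto_atTop_of_isRSymmetricTraj hR hpast i n⟩

end MirrorPulse

end Summit.NavierStokesRegularity.NavierStokesRegularity.Theorems

end
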